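import Mathlib.NumberTheory.Padics.RingHoms
import Mathlib.RingTheory.Nakayama
import Mathlib.RingTheory.AdjoinRoot
import Mathlib.Algebra.CharP.Lemmas

/-!
# Eisenstein-prime local control at a split multiplicative place: `ℤ_p[X]/(X^m + p, (X+1)^{p^s} − 1) ≅ 𝔽_p[X]/(X^{p^s})`

Support algebra for the crux `TwinAlgMuZeroAtThree` (stmt-BirchSwinnertonDyer-24737, R2 text; line `beta-road` v5,
stub `stub_residualCorankLeOneMult` = K2_res), Eisenstein-prime road of the ideation seat `bsd-wall-utd-idea` g62
(`Cruxes/TwinAlgMuZeroAtThree/Ideas/eisenstein-prime-road.md`, `LENS-MEMO-utd-idea-g62.md` §2, §5 [R2], §6 (iv);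
`SketchEisensteinRoad_utd_idea_g62.lean`, candidate `EisensteinSplitControlBound`, of which only the rung `s = 0` was proved).
Width prover `bsd-wall-utd-p1-w2` g10, `--supports stmt-BirchSwinnertonDyer-24737`.

Along Howard's Eisenstein primes `𝔮_m = ((γ - 1)^m + p)` of `Λ = ℤ_p⟦γ - 1⟧` the specialised coefficient ring is
`S_m = Λ/𝔮_m = ℤ_p[X]/(X^m + p)` (totally ramified of degree `m`, uniformiser `π = X`) and the universal character is
`Ψ(γ) = 1 + π`.  At a SPLIT multiplicative place `v ∣ p` of the twin curve whose decomposition group has index `p^s` in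
`Γ = γ^{ℤ_p}`, term (iv) of Howard 2004 Lemma 3.2.7 (arXiv:1202.6340 p. 17) is the module of invariants
`S_m/(Ψ(γ^{p^s}) − 1) = ℤ_p[X]/(X^m + p, (X+1)^{p^s} − 1)`.  THIS FILE computes it exactly, for every prime `p`,
every `s` and every `m ≥ p^s`:

* `span_X_pow_add_C_pair_eq` : `(X^m + p, (X+1)^{p^s} − 1) = (p, X^{p^s})` as ideals of `ℤ_p[X]` (`p^s ≤ m`);
* `natCard_quotient_span_C_X_pow` : `#(ℤ_p[X]/(p, X^k)) = p^k`;
* `natCard_quotient_eisenstein_split_control` : `#(ℤ_p[X]/(X^m + p, (X+1)^{p^s} − 1)) = p^{p^s}` (`p^s ≤ m`);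
* `eisensteinSplitControlBound_three` : the `p = 3` instance, LITERALLY the body of the Sketch's
  `EisensteinSplitControlBound` (`∀ s m, 3^s ≤ m → Nat.card (ℤ_[3][X] ⧸ span {X^m + C 3, (X+1)^(3^s) − 1}) = 3^(3^s)`).

So the B⁺ slack per Eisenstein prime is EXACTLY `p^{p^s}`, finite and independent of `m` — what Howard's approximation
argument `𝔮_m → pΛ` consumes at `v ∣ p`; the ideation seat's numerical table (`v₃ Res(X^m + 3, (1+X)^{3^s} − 1) = 3^s`,
`s ≤ 2`, `3^s ≤ m ≤ 14`) is the case `p = 3` of `natCard_quotient_eisenstein_split_control`.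

Proof.  `(⊆)`: `(X+1)^{p^s} = X^{p^s} + 1 + p·X·r` (`exists_add_pow_prime_pow_eq`).  `(⊇)`: in
`A = ℤ_p[X]/(X^m + p, (X+1)^{p^s} − 1)` the same identity and `p = −x^m` give `x^k = x^k·e` with `k = p^s`,
`e = x^{m−k+1}·r`, hence `x^k = x^k e^m ∈ p·A·x^k`; `A` is module-finite over `ℤ_p` (quotient of the free module
`ℤ_p[X]/(X^m + p)`), so the ideal `A x^k` is a finitely generated `ℤ_p`-module `N` with `N ≤ 𝔪_{ℤ_p} N`, and
NAKAYAMA over the local ring `ℤ_p` gives `N = 0`, i.e. `x^k = 0`, whence `p = −x^{m−k} x^k = 0`.  Then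
`ℤ_p[X]/(p, X^k) ≅ (ℤ_p/p)[X]/(X^k) ≅ 𝔽_p[X]/(X^k)` has a power basis of length `k` over `𝔽_p`.
No named facts, no `sorry`; axioms standard.  BSD is proved for no curve by this file; 24737 stays OPEN.
-/

noncomputable section

open Polynomial

-- `Summit.BirchSwinnertonDyer.BirchSwinnertonDyer.…` is the tree's layout (summit = problem), not a typo.
set_option linter.dupNamespace false

namespace Summit.BirchSwinnertonDyer.BirchSwinnertonDyer.Theorems.UniversalToricDescentEisensteinSplitControl

/-! ## 1. The key identity in an abstract ring -/

/-- In any commutative ring: if `x^m + p = 0` and `(x+1)^{p^s} = 1` with `p` prime and `p^s ≤ m`, then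
`x^{p^s} = p·c·x^{p^s}` for some `c`.  (From `(x+1)^{p^s} = x^{p^s} + 1 + p x r`: `x^{p^s} = −p x r = x^{p^s}·e`,
`e = x^{m − p^s + 1} r`, and `e^m ∈ p·A`.) -/
theorem exists_pow_eq_prime_mul_pow {A : Type*} [CommRing A] {p : ℕ} (hp : p.Prime) (x : A) (s m : ℕ)
    (hm : p ^ s ≤ m) (hx : x ^ m + (p : A) = 0) (hh : (x + 1) ^ (p ^ s) = 1) :
    ∃ c : A, x ^ (p ^ s) = (p : A) * c * x ^ (p ^ s) := by
  set k := p ^ s with hk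
  obtain ⟨r, hr⟩ := exists_add_pow_prime_pow_eq hp x 1 s
  rw [← hk] at hr
  have hpx : (p : A) = -x ^ m := eq_neg_of_add_eq_zero_right hx
  -- `x^k = x^k * e` with `e = x^(m-k+1) * r`
  set e : A := x ^ (m - k + 1) * r with he
  have hxe : x ^ k = x ^ k * e := by
    have h1 : x ^ k + (p : A) * x * r = 0 := by
      have := hr
      rw [hh, one_pow, mul_one] at this
      linear_combination -this
    have h2 : x ^ k = x ^ m * x * r := by
      rw [hpx] at h1
      linear_combination h1
    have h3 : x ^ m = x ^ k * x ^ (m - k) := by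
      rw [← pow_add, Nat.add_sub_cancel' hm]
    rw [he]
    calc x ^ k = x ^ m * x * r := h2
      _ = x ^ k * (x ^ (m - k) * x) * r := by rw [h3]; ring
      _ = x ^ k * (x ^ (m - k + 1) * r) := by rw [pow_succ]; ring
  have hxen : ∀ n : ℕ, x ^ k = x ^ k * e ^ n := by
    intro n
    induction n with
    | zero => simp
    | succ n ih => rw [pow_succ, ← mul_assoc, ← ih]; exact hxe
  have hk1 : 1 ≤ k := hk ▸ Nat.one_le_pow _ _ hp.pos
  have hm1 : 1 ≤ m := le_trans hk1 hm
  -- `e^m = -p * x^((m-k)*m) * r^m`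
  have hem : e ^ m = (p : A) * (-(x ^ ((m - k) * m) * r ^ m)) := by
    rw [he, mul_pow, ← pow_mul, hpx]
    have : (m - k + 1) * m = m + (m - k) * m := by ring
    rw [this, pow_add]
    ring
  refine ⟨-(x ^ ((m - k) * m) * r ^ m), ?_⟩
  calc x ^ k = x ^ k * e ^ m := hxen m
    _ = (p : A) * (-(x ^ ((m - k) * m) * r ^ m)) * x ^ k := by rw [hem]; ring

/-- NAKAYAMA STEP.  In a commutative `ℤ_p`-algebra `A` that is finitely generated as a `ℤ_p`-module: if
`x^m + p = 0` and `(x+1)^{p^s} = 1` with `p^s ≤ m`, then `x^{p^s} = 0`. -/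
theorem pow_prime_pow_eq_zero {p : ℕ} [hp : Fact p.Prime] {A : Type*} [CommRing A] [Algebra ℤ_[p] A]
    [Module.Finite ℤ_[p] A] (x : A) (s m : ℕ) (hm : p ^ s ≤ m) (hx : x ^ m + (p : A) = 0)
    (hh : (x + 1) ^ (p ^ s) = 1) : x ^ (p ^ s) = 0 := by
  obtain ⟨c, hc⟩ := exists_pow_eq_prime_mul_pow hp.out x s m hm hx hh
  -- the ideal `A · x^k` as a `ℤ_p`-submodule
  set N : Submodule ℤ_[p] A := (Ideal.span {x ^ (p ^ s)}).restrictScalars ℤ_[p] with hN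
  have hNfg : N.FG := IsNoetherian.noetherian N
  have hIN : N ≤ (IsLocalRing.maximalIdeal ℤ_[p]) • N := by
    intro y hy
    have hy' : y ∈ Ideal.span {x ^ (p ^ s)} := hy
    obtain ⟨a, rfl⟩ := Ideal.mem_span_singleton'.1 hy'
    have hmem : a * c * x ^ (p ^ s) ∈ N := by
      change a * c * x ^ (p ^ s) ∈ Ideal.span {x ^ (p ^ s)}
      exact Ideal.mul_mem_left _ _ (Ideal.subset_span rfl)
    have hpmem : ((p : ℕ) : ℤ_[p]) ∈ IsLocalRing.maximalIdeal ℤ_[p] := by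
      rw [PadicInt.maximalIdeal_eq_span_p]
      exact Ideal.subset_span rfl
    have heq : a * x ^ (p ^ s) = ((p : ℕ) : ℤ_[p]) • (a * c * x ^ (p ^ s)) := by
      rw [Algebra.smul_def, map_natCast]
      calc a * x ^ (p ^ s) = a * ((p : A) * c * x ^ (p ^ s)) := by rw [← hc]
        _ = (p : A) * (a * c * x ^ (p ^ s)) := by ring
    rw [heq]
    exact Submodule.smul_mem_smul hpmem hmem
  have hjac : IsLocalRing.maximalIdeal ℤ_[p] ≤ (⊥ : Ideal ℤ_[p]).jacobson := by
    rw [IsLocalRing.jacobson_eq_maximalIdeal ⊥ bot_ne_top]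
  have hbot : N = ⊥ := Submodule.eq_bot_of_le_smul_of_le_jacobson_bot _ N hNfg hIN hjac
  have hxN : x ^ (p ^ s) ∈ N := by
    change x ^ (p ^ s) ∈ Ideal.span {x ^ (p ^ s)}
    exact Ideal.subset_span rfl
  rw [hbot] at hxN
  simpa using hxN

/-! ## 2. The ideal identity in `ℤ_p[X]` -/

variable (p : ℕ) [hp : Fact p.Prime]

/-- The Eisenstein polynomial `X^m + p` is monic (`m ≠ 0`). -/
theorem monic_X_pow_add_C_prime {m : ℕ} (hm : m ≠ 0) : (X ^ m + C (p : ℤ_[p]) : ℤ_[p][X]).Monic :=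
  monic_X_pow_add_C _ hm

/-- `ℤ_p[X]/(X^m + p, h)` is a finitely generated `ℤ_p`-module (a quotient of the free module `ℤ_p[X]/(X^m + p)` of
rank `m`), for `m ≠ 0`. -/
theorem moduleFinite_quotient_span_pair {m : ℕ} (hm : m ≠ 0) (h : ℤ_[p][X]) :
    Module.Finite ℤ_[p] (ℤ_[p][X] ⧸ Ideal.span {(X ^ m + C (p : ℤ_[p]) : ℤ_[p][X]), h}) := by
  have hfin : Module.Finite ℤ_[p] (ℤ_[p][X] ⧸ Ideal.span {(X ^ m + C (p : ℤ_[p]) : ℤ_[p][X])}) :=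
    (monic_X_pow_add_C_prime p hm).finite_quotient
  have hle : Ideal.span {(X ^ m + C (p : ℤ_[p]) : ℤ_[p][X])}
      ≤ Ideal.span {(X ^ m + C (p : ℤ_[p]) : ℤ_[p][X]), h} :=
    Ideal.span_mono (by simp)
  exact Module.Finite.of_surjective (Ideal.Quotient.factorₐ ℤ_[p] hle).toLinearMap
    (Ideal.Quotient.factor_surjective hle)

/-- **The ideal identity.**  For `p^s ≤ m`: `(X^m + p, (X+1)^{p^s} − 1) = (p, X^{p^s})` in `ℤ_p[X]`. -/
theorem span_X_pow_add_C_pair_eq (s m : ℕ) (hm : p ^ s ≤ m) :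
    Ideal.span {(X ^ m + C (p : ℤ_[p]) : ℤ_[p][X]), (X + 1) ^ (p ^ s) - 1}
      = Ideal.span {C (p : ℤ_[p]), X ^ (p ^ s)} := by
  have hp' : p.Prime := hp.out
  set k := p ^ s with hk
  have hk1 : 1 ≤ k := hk ▸ Nat.one_le_pow _ _ hp'.pos
  have hm0 : m ≠ 0 := by omega
  set I : Ideal ℤ_[p][X] := Ideal.span {(X ^ m + C (p : ℤ_[p]) : ℤ_[p][X]), (X + 1) ^ k - 1} with hI
  set J : Ideal ℤ_[p][X] := Ideal.span {C (p : ℤ_[p]), X ^ k} with hJ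
  have hCp : (C (p : ℤ_[p]) : ℤ_[p][X]) = (p : ℤ_[p][X]) := map_natCast C p
  apply le_antisymm
  · -- `I ≤ J`
    rw [Ideal.span_le]
    rintro f hf
    simp only [Set.mem_insert_iff, Set.mem_singleton_iff] at hf
    have hpJ : (C (p : ℤ_[p]) : ℤ_[p][X]) ∈ J := Ideal.subset_span (by simp)
    have hXJ : (X ^ k : ℤ_[p][X]) ∈ J := Ideal.subset_span (by simp)
    rcases hf with rfl | rfl
    · have hXm : (X ^ m : ℤ_[p][X]) = X ^ (m - k) * X ^ k := by
        rw [← pow_add, Nat.sub_add_cancel hm]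
      rw [hXm]
      exact J.add_mem (J.mul_mem_left _ hXJ) hpJ
    · obtain ⟨r, hr⟩ := exists_add_pow_prime_pow_eq hp' (X : ℤ_[p][X]) 1 s
      rw [← hk] at hr
      have : ((X + 1) ^ k - 1 : ℤ_[p][X]) = X ^ k + C (p : ℤ_[p]) * (X * r) := by
        rw [hr, hCp]; ring
      rw [this]
      exact J.add_mem hXJ (J.mul_mem_right _ hpJ)
  · -- `J ≤ I`: Nakayama in `A = ℤ_p[X]/I`
    haveI : Module.Finite ℤ_[p] (ℤ_[p][X] ⧸ I) := moduleFinite_quotient_span_pair p hm0 _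
    set x : ℤ_[p][X] ⧸ I := Ideal.Quotient.mk I X with hxdef
    have hgI : (X ^ m + C (p : ℤ_[p]) : ℤ_[p][X]) ∈ I := Ideal.subset_span (by simp)
    have hhI : ((X + 1) ^ k - 1 : ℤ_[p][X]) ∈ I := Ideal.subset_span (by simp)
    have hx : x ^ m + (p : ℤ_[p][X] ⧸ I) = 0 := by
      have := (Ideal.Quotient.eq_zero_iff_mem).2 hgI
      rw [map_add, map_pow, hCp, map_natCast] at this
      exact this
    have hh : (x + 1) ^ k = 1 := by
      have := (Ideal.Quotient.eq_zero_iff_mem).2 hhI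
      rw [map_sub, map_pow, map_add, map_one] at this
      exact sub_eq_zero.1 this
    have hxk : x ^ k = 0 := pow_prime_pow_eq_zero x s m hm hx hh
    have hXkI : (X ^ k : ℤ_[p][X]) ∈ I := by
      rw [← Ideal.Quotient.eq_zero_iff_mem, map_pow]
      exact hxk
    have hpI : (C (p : ℤ_[p]) : ℤ_[p][X]) ∈ I := by
      have hXm : (X ^ m : ℤ_[p][X]) = X ^ (m - k) * X ^ k := by
        rw [← pow_add, Nat.sub_add_cancel hm]
      have h2 : (C (p : ℤ_[p]) : ℤ_[p][X]) = (X ^ m + C (p : ℤ_[p])) - X ^ (m - k) * X ^ k := by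
        rw [hXm]; ring
      rw [h2]
      exact I.sub_mem hgI (I.mul_mem_left _ hXkI)
    rw [Ideal.span_le]
    rintro f hf
    simp only [Set.mem_insert_iff, Set.mem_singleton_iff] at hf
    rcases hf with rfl | rfl
    · exact hpI
    · exact hXkI

/-! ## 3. Counting `ℤ_p[X]/(p, X^k) ≅ 𝔽_p[X]/(X^k)` -/

/-- `ℤ_p/(p) ≃ 𝔽_p`. -/
theorem nonempty_quotient_span_prime_ringEquiv_zmod :
    Nonempty (ℤ_[p] ⧸ Ideal.span {(p : ℤ_[p])} ≃+* ZMod p) := by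
  have hker : RingHom.ker (PadicInt.toZMod : ℤ_[p] →+* ZMod p) = Ideal.span {(p : ℤ_[p])} := by
    rw [PadicInt.ker_toZMod, PadicInt.maximalIdeal_eq_span_p]
  exact ⟨(Ideal.quotEquivOfEq hker.symm).trans
    (RingHom.quotientKerEquivOfSurjective (ZMod.ringHom_surjective PadicInt.toZMod))⟩

/-- `ℤ_p[X]/(p, X^k) ≃ 𝔽_p[X]/(X^k)` (as rings). -/
theorem nonempty_quotient_span_C_X_pow_ringEquiv (k : ℕ) :
    Nonempty ((ℤ_[p][X] ⧸ Ideal.span {C (p : ℤ_[p]), X ^ k})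
      ≃+* ((ZMod p)[X] ⧸ Ideal.span {(X ^ k : (ZMod p)[X])})) := by
  obtain ⟨e0⟩ := nonempty_quotient_span_prime_ringEquiv_zmod p
  set P : Ideal ℤ_[p] := Ideal.span {(p : ℤ_[p])} with hP
  -- (1) `(C p, X^k) = (X^k) ⊔ (C p)` and the double quotient
  have hsplit : (Ideal.span {C (p : ℤ_[p]), X ^ k} : Ideal ℤ_[p][X])
      = Ideal.span {(X ^ k : ℤ_[p][X])} ⊔ Ideal.span {C (p : ℤ_[p])} := by
    rw [Ideal.span_insert, sup_comm]
  let e1 : (ℤ_[p][X] ⧸ Ideal.span {C (p : ℤ_[p]), X ^ k}) ≃+*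
      (ℤ_[p][X] ⧸ Ideal.span {(X ^ k : ℤ_[p][X])}) ⧸
        (Ideal.span {C (p : ℤ_[p])}).map (Ideal.Quotient.mk (Ideal.span {(X ^ k : ℤ_[p][X])})) :=
    (Ideal.quotEquivOfEq hsplit).trans (DoubleQuot.quotQuotEquivQuotSup _ _).symm
  -- (2) the inner ideal is `P.map (AdjoinRoot.of (X^k))`
  have hmap : (Ideal.span {C (p : ℤ_[p])}).map (Ideal.Quotient.mk (Ideal.span {(X ^ k : ℤ_[p][X])}))
      = P.map (AdjoinRoot.of (X ^ k : ℤ_[p][X])) := by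
    rw [Ideal.map_span, Ideal.map_span, Set.image_singleton, Set.image_singleton]
    rfl
  let e2 := (Ideal.quotEquivOfEq hmap).trans
    (AdjoinRoot.quotAdjoinRootEquivQuotPolynomialQuot P (X ^ k : ℤ_[p][X]))
  -- (3) `(X^k).map = X^k` and transport along `ℤ_p/(p) ≃ 𝔽_p`
  have hXk : (X ^ k : ℤ_[p][X]).map (Ideal.Quotient.mk P) = X ^ k := by
    rw [Polynomial.map_pow, Polynomial.map_X]
  have hXk' : Ideal.span {(X ^ k : (ZMod p)[X])}
      = (Ideal.span {(X ^ k : (ℤ_[p] ⧸ P)[X])}).map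
          ((Polynomial.mapEquiv e0 : (ℤ_[p] ⧸ P)[X] ≃+* (ZMod p)[X]) : (ℤ_[p] ⧸ P)[X] →+* (ZMod p)[X]) := by
    rw [Ideal.map_span, Set.image_singleton]
    congr 1
    ext1
    · simp [Polynomial.mapEquiv_apply]
  let e3 : ((ℤ_[p] ⧸ P)[X] ⧸ Ideal.span {((X ^ k : ℤ_[p][X]).map (Ideal.Quotient.mk P))})
      ≃+* ((ZMod p)[X] ⧸ Ideal.span {(X ^ k : (ZMod p)[X])}) :=
    (Ideal.quotEquivOfEq (by rw [hXk])).trans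
      (Ideal.quotientEquiv (Ideal.span {(X ^ k : (ℤ_[p] ⧸ P)[X])}) (Ideal.span {(X ^ k : (ZMod p)[X])})
        (Polynomial.mapEquiv e0) hXk')
  exact ⟨e1.trans (e2.trans e3)⟩

/-- `#(𝔽_p[X]/(X^k)) = p^k`. -/
theorem natCard_zmod_poly_quotient_X_pow (k : ℕ) :
    Nat.card ((ZMod p)[X] ⧸ Ideal.span {(X ^ k : (ZMod p)[X])}) = p ^ k := by
  have hmon : (X ^ k : (ZMod p)[X]).Monic := monic_X_pow k
  let pb := AdjoinRoot.powerBasis' hmon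
  have hdim : pb.dim = k := by
    simp [pb, AdjoinRoot.powerBasis'_dim]
  change Nat.card (AdjoinRoot (X ^ k : (ZMod p)[X])) = p ^ k
  rw [Nat.card_congr pb.basis.equivFun.toEquiv, Nat.card_fun, Nat.card_zmod, Nat.card_fin, hdim]

/-- `#(ℤ_p[X]/(p, X^k)) = p^k`. -/
theorem natCard_quotient_span_C_X_pow (k : ℕ) :
    Nat.card (ℤ_[p][X] ⧸ Ideal.span {C (p : ℤ_[p]), X ^ k}) = p ^ k := by
  obtain ⟨e⟩ := nonempty_quotient_span_C_X_pow_ringEquiv p k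
  rw [Nat.card_congr e.toEquiv, natCard_zmod_poly_quotient_X_pow]

/-! ## 4. The Eisenstein split control count -/

/-- **Eisenstein split control (every prime `p`).**  For `p^s ≤ m`:
`#(ℤ_p[X]/(X^m + p, (X+1)^{p^s} − 1)) = p^{p^s}` — the invariants `S_m/(Ψ(γ^{p^s}) − 1)` of the universal character
on the Eisenstein ring `S_m = ℤ_p[X]/(X^m + p)` have cardinality exactly `p^{p^s}`, independent of `m`. -/
theorem natCard_quotient_eisenstein_split_control (s m : ℕ) (hm : p ^ s ≤ m) :
    Nat.card (ℤ_[p][X] ⧸ Ideal.span {(X ^ m + C (p : ℤ_[p]) : ℤ_[p][X]), (X + 1) ^ (p ^ s) - 1})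
      = p ^ (p ^ s) := by
  rw [span_X_pow_add_C_pair_eq p s m hm, natCard_quotient_span_C_X_pow]

/-- The ring structure behind the count: `ℤ_p[X]/(X^m + p, (X+1)^{p^s} − 1) ≃ 𝔽_p[X]/(X^{p^s})` for `p^s ≤ m`
(in particular an `𝔽_p`-algebra: `p` kills the module of invariants). -/
theorem nonempty_quotient_eisenstein_ringEquiv (s m : ℕ) (hm : p ^ s ≤ m) :
    Nonempty ((ℤ_[p][X] ⧸ Ideal.span {(X ^ m + C (p : ℤ_[p]) : ℤ_[p][X]), (X + 1) ^ (p ^ s) - 1})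
      ≃+* ((ZMod p)[X] ⧸ Ideal.span {(X ^ (p ^ s) : (ZMod p)[X])})) := by
  obtain ⟨e⟩ := nonempty_quotient_span_C_X_pow_ringEquiv p (p ^ s)
  exact ⟨(Ideal.quotEquivOfEq (span_X_pow_add_C_pair_eq p s m hm)).trans e⟩

/-- **`EisensteinSplitControlBound` (the ideation seat's candidate, `p = 3`, ALL `s`) — PROVED.**  Literally the body of
`Summit.BirchSwinnertonDyer.BirchSwinnertonDyer.Cruxes.TwinAlgMuZeroAtThree.EisensteinRoad.EisensteinSplitControlBound`
(`SketchEisensteinRoad_utd_idea_g62.lean`): for all `s m` with `3^s ≤ m`,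
`Nat.card (ℤ_[3][X] ⧸ span {X^m + C 3, (X+1)^(3^s) − 1}) = 3^(3^s)`.  B⁺ rows of bucket B: the local control slack at a
split multiplicative `v ∣ 3` along every Eisenstein prime `𝔮_m`, `m ≥ 3^s`, is exactly `3^{3^s}`. -/
theorem eisensteinSplitControlBound_three :
    ∀ s m : ℕ, 3 ^ s ≤ m →
      Nat.card (Polynomial ℤ_[3] ⧸ Ideal.span
        {(Polynomial.X ^ m + Polynomial.C (3 : ℤ_[3]) : Polynomial ℤ_[3]),
         (Polynomial.X + 1) ^ (3 ^ s) - 1}) = 3 ^ (3 ^ s) := by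
  intro s m hm
  haveI : Fact (Nat.Prime 3) := ⟨Nat.prime_three⟩
  have h := natCard_quotient_eisenstein_split_control 3 s m hm
  have h3 : ((3 : ℕ) : ℤ_[3]) = (3 : ℤ_[3]) := by norm_cast
  rw [h3] at h
  exact h

end Summit.BirchSwinnertonDyer.BirchSwinnertonDyer.Theorems.UniversalToricDescentEisensteinSplitControl

end
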